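import Summits.FinalStateConjecture.FinalStateConjecture.Theorems.ClusterCompletenessAdiabaticMultiKerrILEDPerforatedHardyShell

/-!
# Route ClusterCompleteness — crux `AdiabaticMultiKerrILED`, line `Sketch`: the perforated
# Hardy inequality

Helper file for the crux `stmt-FinalStateConjecture-14310`
(`Summit.FinalStateConjecture.FinalStateConjecture.Theses.ClusterCompleteness.AdiabaticMultiKerrILED`),
closing the stub `stub_perforatedHardy` of line `Sketch`: for `ℝ³` minus `n` balls `B(cᵢ, ρᵢ)`
with `dist(cᵢ, cⱼ) ≥ 4(ρᵢ + ρⱼ)`, a function `φ` of class `C¹` off the closed balls and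
decaying at infinity in the Hardy sense (`∫_{‖y‖>ρ₀} φ²/‖y‖² < ∞`) satisfies
`∫_{dist > 2ρᵢ ∀ i} φ²/‖y − y₀‖² ≤ K ∫_{dist > ρᵢ ∀ i} ‖Dφ‖²` with a universal `K`.

Proof (extension across the holes, then the whole-space inequality). Put
`u = φ + Σᵢ Pᵢ (mᵢ − φ)` with `Pᵢ` the cubical plateau of hole `i` (`= 1` on the cube
`‖y − cᵢ‖_∞ ≤ 1.1ρᵢ ⊇ B̄(cᵢ, ρᵢ)`, `= 0` off `‖y − cᵢ‖_∞ < 1.15ρᵢ ⊆ B(cᵢ, 2ρᵢ)`) and `mᵢ` the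
constant of the shell Poincaré inequality (`shell_poincare`). Then `u ∈ C¹(ℝ³)`, `u = φ` on
`{dist > 2ρᵢ ∀ i}` and at infinity, `Du = 0` inside the inner cubes, `Du = Dφ` off the outer cubes,
and on the shell `Tᵢ`: `Du = (1 − Pᵢ) Dφ + (mᵢ − φ) DPᵢ`, `‖DPᵢ‖ ≤ 60 D₁/ρᵢ`, so
`∫ ‖Du‖² ≤ 2 ∫_{good} ‖Dφ‖² + 2 Σᵢ (60 D₁/ρᵢ)² ∫_{Tᵢ} (φ − mᵢ)² ≤ 2 (1 + 3600 D₁² C) ∫_{good} ‖Dφ‖²`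
(the annuli `{ρᵢ < dist < 4ρᵢ}` being disjoint and inside the good region), and the
whole-space Hardy inequality with decay (`hardy_whole_space_of_decay`, constant `4`) applied to
`u` about `y₀` gives the claim with `K = 8 (1 + 3600 D₁² C)`, `C = 4210701 · 144/25`.

Folklore (capacity/extension argument for Hardy inequalities on exterior domains). [folklore]
-/

noncomputable section

-- the doubled `FinalStateConjecture.FinalStateConjecture` path component trips dupNamespace
set_option linter.dupNamespace false

open Literature.Geometry.Lorentzian MeasureTheory Set Filter Metric
open scoped Topology ENNReal

namespace Summit.FinalStateConjecture.FinalStateConjecture.Cruxes.AdiabaticMultiKerrILED.Sketch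

/-- **Perforated Hardy inequality** (stub `stub_perforatedHardy` of line `Sketch`): `ℝ³` minus
`n` balls `B(cᵢ, ρᵢ)` pairwise far apart (`dist ≥ 4(ρᵢ + ρⱼ)`), `φ` of class `C¹` off the
closed balls and decaying at infinity in the Hardy sense; then
`∫_{dist > 2ρᵢ ∀ i} φ²/‖y − y₀‖² ≤ K ∫_{dist > ρᵢ ∀ i} ‖Dφ‖²` with `K` universal. [folklore] -/
theorem stub_perforatedHardy :
    ∃ K : NNReal, ∀ (n : ℕ) (c : Fin n → E3) (ρ : Fin n → ℝ), (∀ i, 0 < ρ i) →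
      (∀ i j, i ≠ j → 4 * (ρ i + ρ j) ≤ dist (c i) (c j)) →
      ∀ φ : E3 → ℝ, (∀ y : E3, (∀ i, ρ i < dist y (c i)) → ContDiffAt ℝ 1 φ y) →
      (∃ ρ₀ : ℝ, ∫⁻ y in {y : E3 | ρ₀ < ‖y‖}, ENNReal.ofReal (φ y ^ 2 / ‖y‖ ^ 2) < ⊤) →
      ∀ y₀ : E3, ∫⁻ y in {y : E3 | ∀ i, 2 * ρ i < dist y (c i)},
          ENNReal.ofReal (φ y ^ 2 / ‖y - y₀‖ ^ 2) ≤
        (K : ENNReal) * ∫⁻ y in {y : E3 | ∀ i, ρ i < dist y (c i)},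
          ENNReal.ofReal (‖fderiv ℝ φ y‖ ^ 2) := by
  have ofReal_add_sq_le : ∀ a b : ℝ, ENNReal.ofReal ((a + b) ^ 2) ≤
      2 * ENNReal.ofReal (a ^ 2) + 2 * ENNReal.ofReal (b ^ 2) := fun a b => by
    simpa only [sub_neg_eq_add, sub_zero, zero_add] using ofReal_sub_sq_le a (-b) 0
  -- the universal constants: `D` (plateau gradients) and `Cs` (shell Poincaré)
  obtain ⟨D, hD0, hcube⟩ := exists_cube_plateau
  set Cs : ℝ := 4210701 * (144 / 25) with hCs
  have hCs0 : 0 ≤ 3600 * D ^ 2 * Cs := by rw [hCs]; positivity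
  set Kr : ℝ := 8 * (1 + 3600 * D ^ 2 * Cs) with hKr
  refine ⟨Kr.toNNReal, ?_⟩
  intro n c ρ hρ hsep φ hφ hdec y₀
  have hK : ((Kr.toNNReal : NNReal) : ℝ≥0∞) = ENNReal.ofReal Kr := rfl
  rw [hK]
  -- notation
  set Ω' : Set E3 := {y | ∀ i, ρ i < dist y (c i)} with hΩ'
  set Ω'' : Set E3 := {y | ∀ i, 2 * ρ i < dist y (c i)} with hΩ''
  set F : E3 → ℝ≥0∞ := fun y => ENNReal.ofReal (‖fderiv ℝ φ y‖ ^ 2) with hF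
  set G : ℝ≥0∞ := ∫⁻ y in Ω', F y with hG
  have hab : (11 / 10 : ℝ) < 23 / 20 := by norm_num
  -- the cubes of the holes: inner `A i`, outer `K i`, shell `T i = K i ∖ A i`, annulus `N i`
  set A : Fin n → Set E3 := fun i => {y | ∀ k, |y k - c i k| < 11 / 10 * ρ i} with hA
  set K : Fin n → Set E3 := fun i => {y | ∀ k, |y k - c i k| ≤ 23 / 20 * ρ i} with hKset
  set T : Fin n → Set E3 := fun i =>
    {y | (∀ k, |y k - c i k| ≤ 23 / 20 * ρ i) ∧ ¬ ∀ k, |y k - c i k| < 11 / 10 * ρ i} with hTset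
  set N : Fin n → Set E3 := fun i => {y | ρ i < dist y (c i) ∧ dist y (c i) < 4 * ρ i} with hN
  have hKball : ∀ i, K i ⊆ ball (c i) (2 * ρ i) := fun i => outerCube_subset_ball (c i) (hρ i)
  have hballA : ∀ i, closedBall (c i) (ρ i) ⊆ A i := fun i =>
    closedBall_subset_innerCube (c i) (hρ i)
  have hAK : ∀ i, A i ⊆ K i := fun i y hy k => (hy k).le.trans (by linarith [hρ i])
  have hTN : ∀ i, T i ⊆ N i := fun i => cubeShell_subset_annulus (c i) (hρ i)
  have hTm : ∀ i, MeasurableSet (T i) := by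
    intro i
    have h1 : IsClosed (K i) := by
      simp only [hKset, setOf_forall]
      exact isClosed_iInter fun k => isClosed_le (by fun_prop) continuous_const
    have h2 : IsOpen (A i) := by
      simp only [hA, setOf_forall]
      exact isOpen_iInter_of_finite fun k => isOpen_lt (by fun_prop) continuous_const
    exact h1.measurableSet.diff h2.measurableSet
  have hNo : ∀ i, IsOpen (N i) := fun i =>
    (isOpen_lt continuous_const (continuous_id.dist continuous_const)).inter
      (isOpen_lt (continuous_id.dist continuous_const) continuous_const)
  -- the plateaus of the holes
  choose P hPC hP01 hPone hPzero hPD using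
    fun i => hcube (fun k => c i k) (ρ i) (11 / 10) (23 / 20) (hρ i) hab
  have hΩ'open : IsOpen Ω' := by
    rw [hΩ', setOf_forall]
    exact isOpen_iInter_of_finite fun i =>
      isOpen_lt continuous_const (continuous_id.dist continuous_const)
  have hΩ''open : IsOpen Ω'' := by
    rw [hΩ'', setOf_forall]
    exact isOpen_iInter_of_finite fun i =>
      isOpen_lt continuous_const (continuous_id.dist continuous_const)
  -- separation: near hole `i` one is far from hole `j`
  have hsep' : ∀ i j, i ≠ j → ∀ y : E3, dist y (c i) < 4 * ρ i → 4 * ρ j < dist y (c j) := by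
    intro i j hij y hy
    have h1 := hsep i j hij
    have h2 := dist_triangle_left (c i) (c j) y
    linarith
  have hfarK : ∀ i j, i ≠ j → ∀ y : E3, dist y (c i) < 4 * ρ i → y ∉ K j := by
    intro i j hij y hy hK
    have h1 := hsep' i j hij y hy
    have h2 := hKball j hK
    rw [mem_ball] at h2
    linarith [hρ j]
  have hannΩ : ∀ i, N i ⊆ Ω' := by
    intro i y hy j
    by_cases hji : j = i
    · subst hji; exact hy.1
    · linarith [hsep' i j (Ne.symm hji) y hy.2, hρ j]
  -- the plateaus: `P i = 1` near `A i`, `P i = 0` near the complement of `K i`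
  have hP1 : ∀ i, ∀ y ∈ A i, P i =ᶠ[𝓝 y] fun _ => 1 := fun i y hy => hPone i y hy
  have hP0 : ∀ i, ∀ y ∉ K i, P i =ᶠ[𝓝 y] fun _ => 0 := by
    intro i y hy
    refine hPzero i y ?_
    simp only [hKset, mem_setOf_eq, not_forall, not_le] at hy
    exact hy
  have hPothers : ∀ i (y : E3), dist y (c i) < 4 * ρ i →
      ∀ᶠ w in 𝓝 y, ∀ j, j ≠ i → P j w = 0 := by
    intro i y hy
    refine eventually_all.2 fun j => ?_
    by_cases hji : j = i
    · exact Eventually.of_forall fun w h => absurd hji h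
    · exact (hP0 j y (hfarK i j (Ne.symm hji) y hy)).mono fun w hw _ => hw
  -- the shell Poincaré constants
  have hφann : ∀ i (y : E3), ρ i < dist y (c i) → dist y (c i) < 4 * ρ i → ContDiffAt ℝ 1 φ y :=
    fun i y h1 h2 => hφ y (hannΩ i ⟨h1, h2⟩)
  choose m hm using fun i => shell_poincare (c i) (ρ i) (hρ i) φ (hφann i)
  -- the extension
  set u : E3 → ℝ := fun y => φ y + ∑ i, P i y * (m i - φ y) with hu
  have huΩ : ∀ y ∈ Ω', ContDiffAt ℝ 1 u y := by
    intro y hy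
    refine (hφ y hy).add (ContDiffAt.sum fun i _ => ?_)
    exact (hPC i).contDiffAt.mul (contDiffAt_const.sub (hφ y hy))
  have huA : ∀ i, ∀ y ∈ A i, u =ᶠ[𝓝 y] fun _ => m i := by
    intro i y hy
    have hy2 : dist y (c i) < 4 * ρ i := by
      have := hKball i (hAK i hy)
      rw [mem_ball] at this; linarith [hρ i]
    filter_upwards [hP1 i y hy, hPothers i y hy2] with w hw1 hw0
    simp only [hu]
    rw [Finset.sum_eq_single i (fun j _ hj => by rw [hw0 j hj, zero_mul])
      (fun h => absurd (Finset.mem_univ i) h), hw1]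
    ring
  have huC : ∀ y, ContDiffAt ℝ 1 u y := by
    intro y
    by_cases hy : y ∈ Ω'
    · exact huΩ y hy
    · simp only [hΩ', mem_setOf_eq, not_forall, not_lt] at hy
      obtain ⟨i, hi⟩ := hy
      exact contDiffAt_const.congr_of_eventuallyEq
        (huA i y (hballA i (mem_closedBall.2 hi)))
  have huφ : ∀ y : E3, (∀ i, y ∉ K i) → u y = φ y := by
    intro y hy
    simp only [hu]
    rw [Finset.sum_eq_zero fun i _ => by rw [(hP0 i y (hy i)).self_of_nhds, zero_mul], add_zero]
  have hΩ''K : ∀ y ∈ Ω'', ∀ i, y ∉ K i := by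
    intro y hy i hK
    have := hKball i hK
    rw [mem_ball] at this
    linarith [hy i]
  -- the pointwise gradient bound
  set Cθ : Fin n → ℝ := fun i => 3 * (D / ((23 / 20 - 11 / 10) * ρ i)) with hCθ
  set H : Fin n → E3 → ℝ≥0∞ := fun i y => ENNReal.ofReal (Cθ i ^ 2 * (φ y - m i) ^ 2) with hH
  have hgrad : ∀ y, ENNReal.ofReal (‖fderiv ℝ u y‖ ^ 2) ≤
      2 * Ω'.indicator F y + 2 * ∑ i, (T i).indicator (H i) y := by
    intro y
    by_cases h1 : ∃ i, y ∈ K i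
    · obtain ⟨i, hi⟩ := h1
      have hy4 : dist y (c i) < 4 * ρ i := by
        have := hKball i hi
        rw [mem_ball] at this; linarith [hρ i]
      by_cases h2 : y ∈ A i
      · -- inside the inner cube: `u` is locally constant
        rw [(huA i y h2).fderiv_eq, fderiv_const_apply, norm_zero, zero_pow two_ne_zero,
          ENNReal.ofReal_zero]
        exact zero_le
      · -- on the shell `T i`
        have hT : y ∈ T i := ⟨hi, h2⟩
        have hyΩ : y ∈ Ω' := hannΩ i (hTN i hT)
        have hev : u =ᶠ[𝓝 y] fun w => φ w + P i w * (m i - φ w) := by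
          filter_upwards [hPothers i y hy4] with w hw0
          simp only [hu]
          rw [Finset.sum_eq_single i (fun j _ hj => by rw [hw0 j hj, zero_mul])
            (fun h => absurd (Finset.mem_univ i) h)]
        have hφ' : HasFDerivAt φ (fderiv ℝ φ y) y :=
          ((hφ y hyΩ).differentiableAt one_ne_zero).hasFDerivAt
        have hPd : HasFDerivAt (P i) (fderiv ℝ (P i) y) y :=
          (((hPC i).differentiable one_ne_zero) y).hasFDerivAt
        have hprod := hPd.mul (hφ'.const_sub (m i))
        have hsum := hφ'.add hprod
        have e : (fun w => φ w + P i w * (m i - φ w)) = (φ + P i * fun x => m i - φ x) := rfl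
        rw [hev.fderiv_eq, e, hsum.fderiv]
        have hPi := hP01 i y
        have hnorm : ‖fderiv ℝ φ y + (P i y • -fderiv ℝ φ y + (m i - φ y) • fderiv ℝ (P i) y)‖ ≤
            ‖fderiv ℝ φ y‖ + |φ y - m i| * Cθ i := by
          have e : fderiv ℝ φ y + (P i y • -fderiv ℝ φ y + (m i - φ y) • fderiv ℝ (P i) y) =
              (1 - P i y) • fderiv ℝ φ y + (m i - φ y) • fderiv ℝ (P i) y := by
            simp only [sub_smul, one_smul, smul_neg]; abel
          rw [e]
          refine (norm_add_le _ _).trans (add_le_add ?_ ?_)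
          · rw [norm_smul, Real.norm_eq_abs, abs_of_nonneg (by linarith [hPi.2])]
            exact mul_le_of_le_one_left (norm_nonneg _) (by linarith [hPi.1])
          · rw [norm_smul, Real.norm_eq_abs, abs_sub_comm]
            exact mul_le_mul_of_nonneg_left (hPD i y) (abs_nonneg _)
        have hsq : ‖fderiv ℝ φ y + (P i y • -fderiv ℝ φ y + (m i - φ y) • fderiv ℝ (P i) y)‖ ^ 2 ≤
            (‖fderiv ℝ φ y‖ + |φ y - m i| * Cθ i) ^ 2 :=
          pow_le_pow_left₀ (norm_nonneg _) hnorm 2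
        calc _ ≤ ENNReal.ofReal ((‖fderiv ℝ φ y‖ + |φ y - m i| * Cθ i) ^ 2) :=
              ENNReal.ofReal_le_ofReal hsq
          _ ≤ 2 * ENNReal.ofReal (‖fderiv ℝ φ y‖ ^ 2) +
                2 * ENNReal.ofReal ((|φ y - m i| * Cθ i) ^ 2) := ofReal_add_sq_le _ _
          _ = 2 * Ω'.indicator F y + 2 * (T i).indicator (H i) y := by
              rw [indicator_of_mem hyΩ, indicator_of_mem hT, hH]
              simp only [hF]
              congr 3
              rw [mul_pow, sq_abs]; ring
          _ ≤ _ := by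
              gcongr
              exact Finset.single_le_sum (f := fun j => (T j).indicator (H j) y)
                (fun j _ => zero_le) (Finset.mem_univ i)
    · -- off all the cubes: `u = φ` nearby
      simp only [not_exists] at h1
      have hyΩ : y ∈ Ω' := fun i => by
        by_contra h
        exact h1 i (hAK i (hballA i (mem_closedBall.2 (not_lt.1 h))))
      have hev : u =ᶠ[𝓝 y] φ := by
        have hall : ∀ᶠ w in 𝓝 y, ∀ j, P j w = 0 :=
          eventually_all.2 fun j => hP0 j y (h1 j)
        filter_upwards [hall] with w hw
        simp only [hu]
        rw [Finset.sum_eq_zero fun j _ => by rw [hw j, zero_mul], add_zero]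
      rw [hev.fderiv_eq, indicator_of_mem hyΩ]
      calc ENNReal.ofReal (‖fderiv ℝ φ y‖ ^ 2) = 1 * F y := by rw [one_mul]
        _ ≤ 2 * F y := by gcongr; norm_num
        _ ≤ _ := le_self_add
  -- measurability
  have hcontφ : ContinuousOn φ Ω' := fun y hy => (hφ y hy).continuousAt.continuousWithinAt
  have hFm : AEMeasurable F (volume.restrict Ω') := by
    have hcont : ContDiffOn ℝ 1 φ Ω' := fun y hy => (hφ y hy).contDiffWithinAt
    have hDc : ContinuousOn (fderiv ℝ φ) Ω' := hcont.continuousOn_fderiv_of_isOpen hΩ'open le_rfl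
    exact (ENNReal.continuous_ofReal.comp_continuousOn
      ((continuous_pow 2).comp_continuousOn hDc.norm)).aemeasurable hΩ'open.measurableSet
  have hHm : ∀ i, AEMeasurable (H i) (volume.restrict (T i)) := by
    intro i
    have hφm : AEMeasurable φ (volume.restrict (T i)) :=
      (hcontφ.aemeasurable hΩ'open.measurableSet).mono_set ((hTN i).trans (hannΩ i))
    exact (((hφm.sub_const _).pow_const 2).const_mul _).ennreal_ofReal
  -- integrate the gradient bound
  have hint : ∫⁻ y, ENNReal.ofReal (‖fderiv ℝ u y‖ ^ 2) ≤
      2 * G + 2 * ∑ i, ∫⁻ y in T i, H i y := by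
    have hind : AEMeasurable (Ω'.indicator F) volume :=
      (aemeasurable_indicator_iff hΩ'open.measurableSet).2 hFm
    have hindH : ∀ i, AEMeasurable ((T i).indicator (H i)) volume := fun i =>
      (aemeasurable_indicator_iff (hTm i)).2 (hHm i)
    calc ∫⁻ y, ENNReal.ofReal (‖fderiv ℝ u y‖ ^ 2)
        ≤ ∫⁻ y, (2 * Ω'.indicator F y + 2 * ∑ i, (T i).indicator (H i) y) :=
          lintegral_mono hgrad
      _ = (2 * ∫⁻ y, Ω'.indicator F y) +
            2 * ∫⁻ y, ∑ i, (T i).indicator (H i) y := by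
          rw [lintegral_add_left' (hind.const_mul _), lintegral_const_mul' _ _ ENNReal.ofNat_ne_top,
            lintegral_const_mul' _ _ ENNReal.ofNat_ne_top]
      _ = 2 * G + 2 * ∑ i, ∫⁻ y in T i, H i y := by
          rw [lintegral_indicator hΩ'open.measurableSet, lintegral_finsetSum' _ fun i _ => hindH i]
          congr 2
          exact Finset.sum_congr rfl fun i _ => lintegral_indicator (hTm i) _
  -- the shell terms
  have hshell : ∀ i, ∫⁻ y in T i, H i y ≤
      ENNReal.ofReal (3600 * D ^ 2 * Cs) *
        ∫⁻ y in N i, F y := by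
    intro i
    have hρi := hρ i
    have hc : ENNReal.ofReal (Cθ i ^ 2) * ENNReal.ofReal (Cs * ρ i ^ 2) =
        ENNReal.ofReal (3600 * D ^ 2 * Cs) := by
      rw [← ENNReal.ofReal_mul (sq_nonneg _)]
      congr 1
      have h1 : Cθ i * ρ i = 60 * D := by
        rw [hCθ]
        have e : (23 / 20 - 11 / 10 : ℝ) = 1 / 20 := by norm_num
        simp only [e]
        field_simp
        ring
      calc Cθ i ^ 2 * (Cs * ρ i ^ 2) = (Cθ i * ρ i) ^ 2 * Cs := by ring
        _ = 3600 * D ^ 2 * Cs := by rw [h1]; ring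
    calc ∫⁻ y in T i, H i y
        = ENNReal.ofReal (Cθ i ^ 2) * ∫⁻ y in T i, ENNReal.ofReal ((φ y - m i) ^ 2) := by
          rw [← lintegral_const_mul' _ _ ENNReal.ofReal_ne_top]
          refine lintegral_congr fun y => ?_
          show ENNReal.ofReal (Cθ i ^ 2 * (φ y - m i) ^ 2) = _
          rw [ENNReal.ofReal_mul (sq_nonneg _)]
      _ ≤ ENNReal.ofReal (Cθ i ^ 2) * (ENNReal.ofReal (Cs * ρ i ^ 2) *
            ∫⁻ y in N i, F y) := by gcongr; exact hm i
      _ = _ := by rw [← mul_assoc, hc]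
  -- the annuli are disjoint and inside the good region
  have hdisj : Pairwise (Function.onFun Disjoint N) := by
    intro i j hij
    refine disjoint_left.2 fun y hyi hyj => ?_
    have h1 := hsep' i j hij y hyi.2
    linarith [hyj.2]
  have hsumG : ∑ i, ∫⁻ y in N i, F y ≤ G := by
    calc ∑ i, ∫⁻ y in N i, F y = ∑' i, ∫⁻ y in N i, F y :=
          (tsum_fintype _).symm
      _ = ∫⁻ y in ⋃ i, N i, F y :=
          (lintegral_iUnion (fun i => (hNo i).measurableSet) hdisj F).symm
      _ ≤ G := lintegral_mono_set (iUnion_subset hannΩ)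
  have hDu : ∫⁻ y, ENNReal.ofReal (‖fderiv ℝ u y‖ ^ 2) ≤
      2 * G + 2 * (ENNReal.ofReal (3600 * D ^ 2 * Cs) * G) := by
    refine hint.trans (add_le_add le_rfl ?_)
    gcongr 2 * ?_
    calc ∑ i, ∫⁻ y in T i, H i y
        ≤ ∑ i, ENNReal.ofReal (3600 * D ^ 2 * Cs) *
            ∫⁻ y in N i, F y := Finset.sum_le_sum fun i _ => hshell i
      _ = ENNReal.ofReal (3600 * D ^ 2 * Cs) *
            ∑ i, ∫⁻ y in N i, F y := by rw [Finset.mul_sum]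
      _ ≤ _ := by gcongr
  -- decay of `u` at infinity: `u = φ` outside a large ball
  have hdecu : ∃ R : ℝ, ∫⁻ y in {y : E3 | R < ‖y‖}, ENNReal.ofReal (u y ^ 2 / ‖y‖ ^ 2) < ⊤ := by
    obtain ⟨ρ₀, hρ₀⟩ := hdec
    set R₀ : ℝ := ∑ i, (‖c i‖ + 2 * ρ i) with hR₀
    refine ⟨max ρ₀ R₀, ?_⟩
    have hfar : ∀ y : E3, max ρ₀ R₀ < ‖y‖ → ∀ i, y ∉ K i := by
      intro y hy i hK
      have h1 : ‖c i‖ + 2 * ρ i ≤ R₀ := by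
        rw [hR₀]
        exact Finset.single_le_sum (f := fun j => ‖c j‖ + 2 * ρ j)
          (fun j _ => by linarith [norm_nonneg (c j), hρ j]) (Finset.mem_univ i)
      have h2 := hKball i hK
      rw [mem_ball, dist_eq_norm] at h2
      have h3 : ‖y‖ ≤ ‖y - c i‖ + ‖c i‖ := norm_le_norm_sub_add y (c i)
      linarith [le_max_right ρ₀ R₀]
    have hmeas : MeasurableSet {y : E3 | max ρ₀ R₀ < ‖y‖} :=
      (isOpen_lt continuous_const continuous_norm).measurableSet
    calc ∫⁻ y in {y : E3 | max ρ₀ R₀ < ‖y‖}, ENNReal.ofReal (u y ^ 2 / ‖y‖ ^ 2)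
        = ∫⁻ y in {y : E3 | max ρ₀ R₀ < ‖y‖}, ENNReal.ofReal (φ y ^ 2 / ‖y‖ ^ 2) :=
          setLIntegral_congr_fun hmeas fun y hy => by rw [huφ y (hfar y hy)]
      _ ≤ ∫⁻ y in {y : E3 | ρ₀ < ‖y‖}, ENNReal.ofReal (φ y ^ 2 / ‖y‖ ^ 2) :=
          lintegral_mono_set fun y (hy : max ρ₀ R₀ < ‖y‖) =>
            show ρ₀ < ‖y‖ from lt_of_le_of_lt (le_max_left _ _) hy
      _ < ⊤ := hρ₀
  -- the whole-space Hardy inequality for `u`, and the conclusion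
  have hHardy := hardy_whole_space_of_decay u huC hdecu y₀
  have hconst : 4 * (2 * G + 2 * (ENNReal.ofReal (3600 * D ^ 2 * Cs) * G)) =
      ENNReal.ofReal Kr * G := by
    have h8 : ENNReal.ofReal Kr = 8 * (1 + ENNReal.ofReal (3600 * D ^ 2 * Cs)) := by
      rw [hKr, ENNReal.ofReal_mul (by norm_num), ENNReal.ofReal_add zero_le_one hCs0,
        ENNReal.ofReal_one, ENNReal.ofReal_ofNat]
    rw [h8]
    ring
  calc ∫⁻ y in Ω'', ENNReal.ofReal (φ y ^ 2 / ‖y - y₀‖ ^ 2)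
      = ∫⁻ y in Ω'', ENNReal.ofReal (u y ^ 2 / ‖y - y₀‖ ^ 2) :=
        setLIntegral_congr_fun hΩ''open.measurableSet fun y hy => by rw [huφ y (hΩ''K y hy)]
    _ ≤ ∫⁻ y, ENNReal.ofReal (u y ^ 2 / ‖y - y₀‖ ^ 2) := setLIntegral_le_lintegral _ _
    _ ≤ 4 * ∫⁻ y, ENNReal.ofReal (‖fderiv ℝ u y‖ ^ 2) := hHardy
    _ ≤ 4 * (2 * G + 2 * (ENNReal.ofReal (3600 * D ^ 2 * Cs) * G)) := by
        gcongr
    _ = ENNReal.ofReal Kr * G := hconst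

end Summit.FinalStateConjecture.FinalStateConjecture.Cruxes.AdiabaticMultiKerrILED.Sketch

end
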